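import Summits.NavierStokesRegularity.NavierStokesRegularity.Theorems.SoloSalvageWu2026TangentPressure
import Summits.NavierStokesRegularity.NavierStokesRegularity.Theorems.SoloSalvageWu2026WeakNormSq
import Summits.NavierStokesRegularity.NavierStokesRegularity.Theorems.SoloSalvageWu2026WeakChain
import HarnessLib

/-!
# C177 `Wu2026` — TRUE column, Prop 3.3: `Step_P33` HOLDS (the Sobolev Bernoulli companion law)

D-0090 NS-CLAIMS sweep, claim C177 (W. Wu, *The Global Weak-Lorentz Vorticity Endpoint in the
Stationary Navier–Stokes Liouville Problem*, arXiv:2608.22471v1), skeleton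
`Literature/Claims/NS/Wu2026.lean` (typist-10 g6; rev 2); kernel object for the binder `hP33` of
`claim_of_steps''` / `wu2026_thm11_of_four_open_steps` — **Proposition 3.3 (Sobolev Bernoulli
companion law)** p.20 l.23–32 «For every β ∈ C¹(R) with ‖β′‖_∞ < ∞, the Euler tangent satisfies
div(β(Q)V) = 0 in D′({|y| > 1}). (3.60)», typed as `Step_P33`.

Proof (the printed route p.20 l.33–105, kernel version; parts 1–7 supply the tools). Fix a test
function `φ ∈ C_c^∞({|y| > 1})` and an open neighbourhood `O` of its support with compact
closure in `{|y| > 1}`. On `O`: `V ∈ L^{9/2}` with weak gradient `∇V ∈ L^{9/5}` ((3.35),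
`Tangent.exists_hasWeakFDerivOn`), `P ∈ L^{3/2}` (`Tangent.locInt`); the Euler system (3.51)
gives `∇P = −(V·∇)V` weakly (`hasWeakFDerivOn_pressure`), the product rule gives
`∇(|V|²/2) = (∇V)ᵀV` (`hasWeakFDerivOn_half_norm_sq`), so `Q = P + |V|²/2` has the weak gradient
`∇Q·w = ⟪V, ∂_wV⟫ − ⟪(V·∇)V, w⟫` — the antisymmetric (Lamb) form of (3.52) `∇Q = V × curl V`,
with `∇Q·V = 0` identically; the chain rule (`hasWeakFDerivOn_comp_of_deriv_bound`) gives
`∇β(Q) = β′(Q)∇Q ∈ L^{9/7}`, and the transport identity for the divergence-free `V`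
(`integral_mul_fderiv_apply_eq_of_divFree`, pairing `7/9 + 2/9 = 1`) gives
`∫ β(Q) V·∇φ = −∫ φ β′(Q) ∇Q·V = 0`, i.e. (3.60).

* `Tangent.weakDivFreeOn_comp` — the companion law for every tangent and every admissible `β`;
* `step_P33 : Step_P33`.

Seat ns-in-wu-p33 (cell pub/ns-inputs, D-0154 (2) INPUTS, director-ns req136). Records, not a
verdict on the preprint (row #164 lettered «discharges»). WHAT THIS IS NOT: not a claim about NS
regularity or blow-up; no summit statement is proved here; proving this input makes the
conditional composition `wu2026_thm11_of_four_open_steps` unconditional in its `hP33` slot only.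
-/

noncomputable section

set_option linter.dupNamespace false

open MeasureTheory TopologicalSpace Set Function Filter Topology Metric
open scoped ENNReal NNReal Topology ContDiff RealInnerProductSpace

namespace Summit.NavierStokesRegularity.NavierStokesRegularity.Theorems.Wu2026Salvage

open Literature.Analysis.FluidPDE Literature.Analysis.FunctionSpaces Literature.Claims.NS.Wu2026

/-! ### Exponent bookkeeping in `ℝ≥0∞` -/

/-- `1 ≤ 3/2`, `3/2 ≠ ∞`, `1 ≤ 9/7`, `9/7 ≠ ∞`, `1 ≤ 9/2`, `9/2 ≠ ∞`, `9/7 ≤ 9/5`, `9/7 ≤ 9/2`,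
`3 ≤ 9/2` in `ℝ≥0∞` (the exponents of Prop 3.3). [folklore] -/
theorem p33_exponents :
    (1 : ℝ≥0∞) ≤ 3 / 2 ∧ (3 : ℝ≥0∞) / 2 ≠ ⊤ ∧ (1 : ℝ≥0∞) ≤ 9 / 7 ∧ (9 : ℝ≥0∞) / 7 ≠ ⊤ ∧
    (1 : ℝ≥0∞) ≤ 9 / 2 ∧ (9 : ℝ≥0∞) / 2 ≠ ⊤ ∧ (9 : ℝ≥0∞) / 7 ≤ 9 / 5 ∧
    (9 : ℝ≥0∞) / 7 ≤ 9 / 2 ∧ (3 : ℝ≥0∞) ≤ 9 / 2 := by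
  refine ⟨?_, ENNReal.div_ne_top (by norm_num) (by norm_num), ?_,
    ENNReal.div_ne_top (by norm_num) (by norm_num), ?_, ENNReal.div_ne_top (by norm_num) (by norm_num),
    ENNReal.div_le_div_left (by norm_num) _, ENNReal.div_le_div_left (by norm_num) _, ?_⟩
  · rw [ENNReal.le_div_iff_mul_le (by norm_num) (by norm_num)]; norm_num
  · rw [ENNReal.le_div_iff_mul_le (by norm_num) (by norm_num)]; norm_num
  · rw [ENNReal.le_div_iff_mul_le (by norm_num) (by norm_num)]; norm_num
  · rw [ENNReal.le_div_iff_mul_le (by norm_num) (by norm_num)]; norm_num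

/-! ### Geometry: a relatively compact open neighbourhood of the support -/

/-- For a compact `K ⊆ {|y| > 1}` there are an open `O ⊇ K` and a compact `K'` with
`O ⊆ K' ⊆ {|y| > 1}` (a `δ`-thickening and the closed `δ`-thickening). [folklore] -/
theorem exists_opens_between {K : Set E3} (hK : IsCompact K) (hKU : K ⊆ exterior) :
    ∃ (O : Opens E3) (K' : Set E3), K ⊆ (O : Set E3) ∧ (O : Set E3) ⊆ K' ∧ IsCompact K' ∧
      K' ⊆ exterior := by
  obtain ⟨δ, hδ, hδU⟩ := hK.exists_cthickening_subset_open isOpen_exterior hKU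
  exact ⟨⟨thickening δ K, isOpen_thickening⟩, cthickening δ K, self_subset_thickening hδ K,
    thickening_subset_cthickening δ K, hK.cthickening, hδU⟩

/-! ### `∇Q = (∇V)ᵀV − (V·∇)V ∈ L^{9/7}` -/

/-- The Lamb-form gradient `w ↦ ⟪V, ∂_wV⟫ − ⟪(V·∇)V, w⟫` is in `L^{9/7}` for `V ∈ L^{9/2}`,
`∇V ∈ L^{9/5}` (p.20 l.45–55, «2/9 + 5/9 = 7/9»). [cite: Wu2026, Prop 3.3 proof p.20 l.45–55] -/
theorem memLp_gradQ {O : Set E3} {V : E3 → E3} {gV : E3 → E3 →L[ℝ] E3}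
    (hV : MemLp V ((9 : ℝ≥0∞) / 2) (volume.restrict O))
    (hgV : MemLp gV ((9 : ℝ≥0∞) / 5) (volume.restrict O)) :
    MemLp (fun y => -(innerSL ℝ (gV y (V y))) + (innerSL ℝ (V y)).comp (gV y)) ((9 : ℝ≥0∞) / 7)
      (volume.restrict O) := by
  haveI := holderTriple_nineHalves_nineFifths
  have hm : AEStronglyMeasurable (fun y => -(innerSL ℝ (gV y (V y))) + (innerSL ℝ (V y)).comp (gV y))
      (volume.restrict O) :=
    (memLp_neg_innerSL_apply hV hgV).1.add (memLp_innerSL_comp hV hgV).1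
  refine ⟨hm, ?_⟩
  have h := eLpNorm_le_eLpNorm_mul_eLpNorm_of_nnnorm (μ := volume.restrict O) hV.1 hgV.1
    (fun (u : E3) (M : E3 →L[ℝ] E3) => -(innerSL ℝ (M u)) + (innerSL ℝ u).comp M) 2
    (Eventually.of_forall fun y => by
      rw [← NNReal.coe_le_coe, coe_nnnorm, NNReal.coe_mul, NNReal.coe_mul, coe_nnnorm, coe_nnnorm,
        NNReal.coe_ofNat]
      refine (norm_add_le _ _).trans ?_
      rw [norm_neg, innerSL_apply_norm, two_mul, add_mul]
      refine add_le_add (by rw [mul_comm]; exact (gV y).le_opNorm _) ?_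
      exact (ContinuousLinearMap.opNorm_comp_le _ _).trans (by rw [innerSL_apply_norm]))
    (p := (9 : ℝ≥0∞) / 2) (q := (9 : ℝ≥0∞) / 5) (r := (9 : ℝ≥0∞) / 7)
  refine lt_of_le_of_lt h ?_
  exact ENNReal.mul_lt_top (ENNReal.mul_lt_top ENNReal.coe_lt_top hV.eLpNorm_lt_top)
    hgV.eLpNorm_lt_top

section Main

variable {ν : ℝ} {v : E3 → E3} {p : E3 → ℝ}

/-- `P ∈ L^{3/2}(K)` for compact `K ⊆ ℝ³ ∖ {0}`: the field `Tangent.locInt` gives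
`P ∈ L^{q₀/2}_loc(ℝ³ ∖ {0})` with `3 < q₀` ((3.45)/(3.47)). [cite: Wu2026, (3.45)–(3.47) p.16] -/
theorem Tangent.memLp_P_threeHalves (T : Tangent ν v p) {K : Set E3} (hK : IsCompact K)
    (hKU : K ⊆ punctured) : MemLp T.P ((3 : ℝ≥0∞) / 2) (volume.restrict K) := by
  obtain ⟨-, hPm, hloc⟩ := T.locInt
  obtain ⟨hq3, -⟩ := T.hq0
  have hr0 : 0 < T.q0 / 2 := by linarith
  haveI : IsFiniteMeasure (volume.restrict K) :=
    ⟨by rw [Measure.restrict_apply_univ]; exact hK.measure_lt_top⟩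
  have h1 : MemLp T.P (ENNReal.ofReal (T.q0 / 2)) (volume.restrict K) := by
    refine memLp_of_integrableOn_norm_rpow (ne_of_gt (ENNReal.ofReal_pos.2 hr0))
      ENNReal.ofReal_ne_top hPm.restrict ?_
    rw [ENNReal.toReal_ofReal hr0.le]
    simpa only [Real.norm_eq_abs] using (hloc K hK hKU).2
  refine h1.mono_exponent ?_
  rw [show ((3 : ℝ≥0∞) / 2) = ENNReal.ofReal ((3 : ℝ) / 2) by
    rw [ENNReal.ofReal_div_of_pos two_pos]; simp]
  exact ENNReal.ofReal_le_ofReal (by linarith)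

/-- **Proposition 3.3 for a given tangent** (p.20 l.23–105): for every `β ∈ C¹(ℝ)` with `β′`
bounded, `div(β(Q)V) = 0` in `D′({|y| > 1})`, `Q = P + |V|²/2`. See the module docstring for
the route (∇P from (3.51), product rule, antisymmetric Lamb form `∇Q·V = 0`, chain rule,
transport identity for the divergence-free `V`). [cite: Wu2026, Prop 3.3 p.20 l.23–105] -/
theorem Tangent.weakDivFreeOn_comp (T : Tangent ν v p) {β : ℝ → ℝ} (hβ : ContDiff ℝ 1 β)
    (hβ' : ∃ L : ℝ, ∀ z, ‖deriv β z‖ ≤ L) :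
    WeakDivFreeOn exterior (fun y => β (T.Q y) • T.V y) := by
  intro φ hφ
  obtain ⟨hφs, hφc, hφU⟩ := hφ
  obtain ⟨L, hL⟩ := hβ'
  haveI := holderTriple_nineHalves_nineSevenths
  haveI := holderTriple_threeHalves_three'
  obtain ⟨h1le32, h32top, h1le97, h97top, h1le92, h92top, h97le95, h97le92, h3le92⟩ := p33_exponents
  -- the neighbourhood `O` of `tsupport φ` and the integrability of the tangent on it
  obtain ⟨O, K', hKO, hOK', hK', hK'U⟩ := exists_opens_between (K := tsupport φ) hφc hφU
  have hOU : (O : Set E3) ⊆ exterior := hOK'.trans hK'U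
  have hOpunct : (O : Set E3) ⊆ punctured := hOU.trans exterior_subset_punctured
  haveI : IsFiniteMeasure (volume.restrict (O : Set E3)) :=
    ⟨by rw [Measure.restrict_apply_univ]; exact (measure_mono hOK').trans_lt hK'.measure_lt_top⟩
  have hνO : volume.restrict (O : Set E3) ≤ volume.restrict K' := Measure.restrict_mono hOK' le_rfl
  obtain ⟨gV, hgVw, hgVK⟩ := Tangent.exists_hasWeakFDerivOn T
  have hVw : HasWeakFDerivOn O volume T.V gV :=
    HasWeakFDerivOn.mono_set_holds hgVw (show (O : Set E3) ⊆ exterior from hOU)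
  have hV92 : MemLp T.V ((9 : ℝ≥0∞) / 2) (volume.restrict O) :=
    (Tangent.memLp_V_nineHalves T hK' hK'U).mono_measure hνO
  have hgV95 : MemLp gV ((9 : ℝ≥0∞) / 5) (volume.restrict O) := (hgVK K' hK' hK'U).mono_measure hνO
  have hV3 : MemLp T.V 3 (volume.restrict O) := hV92.mono_exponent h3le92
  have hV97 : MemLp T.V ((9 : ℝ≥0∞) / 7) (volume.restrict O) := hV92.mono_exponent h97le92
  have hgV97 : MemLp gV ((9 : ℝ≥0∞) / 7) (volume.restrict O) := hgV95.mono_exponent h97le95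
  have hP32 : MemLp T.P ((3 : ℝ≥0∞) / 2) (volume.restrict O) :=
    (Tangent.memLp_P_threeHalves T hK' (hK'U.trans exterior_subset_punctured)).mono_measure hνO
  -- `div V = 0` and the Euler identity, for test functions supported in `O`
  have hdiv : ∀ ψ : E3 → ℝ, ContDiff ℝ ∞ ψ → HasCompactSupport ψ → tsupport ψ ⊆ (O : Set E3) →
      ∫ x, fderiv ℝ ψ x (T.V x) = 0 := fun ψ h1 h2 h3 =>
    Tangent.divFree_fderiv T h1 h2 (h3.trans hOpunct)
  have heul : ∀ ψ : E3 → ℝ, ContDiff ℝ ∞ ψ → HasCompactSupport ψ → tsupport ψ ⊆ (O : Set E3) →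
      ∀ w : E3, ∫ y, (fderiv ℝ ψ y (T.V y) * ⟪T.V y, w⟫ + T.P y * fderiv ℝ ψ y w) = 0 :=
    fun ψ h1 h2 h3 w => Tangent.euler_smul_const T h1 h2 (h3.trans hOpunct) w
  -- `∇P = -(V·∇)V`, `∇(|V|²/2) = (∇V)ᵀV`, hence `∇Q`, with `∇Q·V = 0`
  have hPw := hasWeakFDerivOn_pressure hVw hV92 hgV95 hP32 hdiv heul
  have hNw := hasWeakFDerivOn_half_norm_sq (p := (9 : ℝ≥0∞) / 2) (p' := 9 / 7) h1le92 h92top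
    h1le97 h97top hVw hV92 hV97 hgV97
  obtain ⟨gQ, hgQ⟩ : ∃ gQ : E3 → E3 →L[ℝ] ℝ,
      ∀ y, gQ y = -(innerSL ℝ (gV y (T.V y))) + (innerSL ℝ (T.V y)).comp (gV y) :=
    ⟨_, fun y => rfl⟩
  have hQw : HasWeakFDerivOn O volume T.Q gQ :=
    SobolevApprox.hasWeakFDerivOn_congr (SobolevApprox.hasWeakFDerivOn_add hPw hNw)
      (fun y _ => rfl) (fun y _ => hgQ y)
  have hgQV : ∀ y, gQ y (T.V y) = 0 := fun y => by
    rw [hgQ y, add_apply, neg_apply, innerSL_apply_apply,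
      ContinuousLinearMap.comp_apply, innerSL_apply_apply, real_inner_comm, neg_add_cancel]
  -- `Q ∈ L^{3/2}(O)`, `∇Q ∈ L^{9/7}(O)`
  have hN32 : MemLp (fun y => ‖T.V y‖ ^ 2 / 2) ((3 : ℝ≥0∞) / 2) (volume.restrict O) := by
    have h := (hV3.norm_rpow_div 2).const_mul (1 / 2 : ℝ)
    refine h.ae_eq (Eventually.of_forall fun y => ?_)
    simp only [ENNReal.toReal_ofNat, Real.rpow_two]
    ring
  have hQ32 : MemLp T.Q ((3 : ℝ≥0∞) / 2) (volume.restrict O) :=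
    (hP32.add hN32).ae_eq (Eventually.of_forall fun y => rfl)
  have hgQ97 : MemLp gQ ((9 : ℝ≥0∞) / 7) (volume.restrict O) :=
    (memLp_gradQ hV92 hgV95).ae_eq (Eventually.of_forall fun y => (hgQ y).symm)
  have hQm : AEStronglyMeasurable T.Q (volume.restrict O) := hQ32.1
  -- `θ = β ∘ Q`: chain rule, `θ ∈ L^{3/2}(O)`, `∇θ = β'(Q)∇Q ∈ L^{9/7}(O)`
  have hθw := hasWeakFDerivOn_comp_of_deriv_bound (p := (3 : ℝ≥0∞) / 2) (q := 9 / 7) h1le32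
    h32top h1le97 h97top hQw hQ32 hgQ97 hβ hL
  have hβc : Continuous β := hβ.continuous
  have hβ'c : Continuous (deriv β) := hβ.continuous_deriv le_rfl
  have hlip := abs_sub_le_of_deriv_bound hβ hL
  have hθ32 : MemLp (fun y => β (T.Q y)) ((3 : ℝ≥0∞) / 2) (volume.restrict O) := by
    have h1 : MemLp (fun y => β (T.Q y) - β 0) ((3 : ℝ≥0∞) / 2) (volume.restrict O) := by
      refine hQ32.of_le_mul ((hβc.comp_aestronglyMeasurable hQm).sub aestronglyMeasurable_const)
        (c := L) (Eventually.of_forall fun y => ?_)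
      rw [Real.norm_eq_abs, Real.norm_eq_abs]
      simpa only [sub_zero] using hlip (T.Q y) 0
    exact (h1.add (memLp_const (β 0))).ae_eq (Eventually.of_forall fun y => by simp)
  have hgθ97 : MemLp (fun y => deriv β (T.Q y) • gQ y) ((9 : ℝ≥0∞) / 7) (volume.restrict O) := by
    refine hgQ97.of_le_mul ((hβ'c.comp_aestronglyMeasurable hQm).smul hgQ97.1) (c := L)
      (Eventually.of_forall fun y => ?_)
    rw [norm_smul]
    exact mul_le_mul_of_nonneg_right (hL _) (norm_nonneg _)
  -- the transport identity: `∫ β(Q) ∇φ·V = -∫ φ β'(Q) ∇Q·V = 0`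
  have htr := integral_mul_fderiv_apply_eq_of_divFree (p := (3 : ℝ≥0∞) / 2) (p' := 3)
    (q := (9 : ℝ≥0∞) / 7) (q' := 9 / 2) h1le32 h32top h1le97 h97top hθw hθ32 hgθ97 hV3 hV92 hdiv
    hφs hφc hKO
  have h0 : ∀ y, (deriv β (T.Q y) • gQ y) (T.V y) = 0 := fun y => by
    rw [smul_apply, hgQV, smul_zero]
  simp only [h0, mul_zero, integral_zero, neg_zero] at htr
  simpa only [real_inner_smul_left, inner_gradient_eq_fderiv] using htr

end Main

/-- **`Step_P33` holds** — Proposition 3.3 (Sobolev Bernoulli companion law) p.20 l.23–32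
«For every β ∈ C¹(R) with ‖β′‖_∞ < ∞, the Euler tangent satisfies div(β(Q)V) = 0 in
D′({|y| > 1}). (3.60)», exactly as typed in `Literature/Claims/NS/Wu2026.lean` (the hypotheses
`IsWuFlow`, `0 < D(v)` of the binder are not used: the statement holds for every `Tangent`).
[cite: Wu2026, Prop 3.3 p.20 l.23–32] -/
theorem step_P33 : Step_P33 :=
  fun _ν _hν _v _p _hflow _hD T _β hβ hβ' => Tangent.weakDivFreeOn_comp T hβ hβ'

end Summit.NavierStokesRegularity.NavierStokesRegularity.Theorems.Wu2026Salvage
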